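import Literature.NumberTheory.EllipticCurves.TamagawaRingEquivProofs
import Literature.NumberTheory.EllipticCurves.TamagawaProofs
import Literature.NumberTheory.DiophantineGeometry.MinimalDiscriminantRingOfIntegersProofs
import Literature.NumberTheory.DiophantineGeometry.MinimalDiscriminantNormProofs
import Literature.NumberTheory.DiophantineGeometry.MinimalDiscriminantProofs
import Literature.NumberTheory.DiophantineGeometry.LocalReductionMinimalityProofs
import Literature.NumberTheory.Automorphic.GaloisActionPlaces
import Mathlib.RingTheory.Ideal.Int
import HarnessLib

/-!
# The modified Tamagawa product `C(E/K) = ∏_v c_v |ω/ω_v°|_v` of Dokchitser–Dokchitser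

Topic `NumberTheory/EllipticCurves`. T. Dokchitser, V. Dokchitser, *On the Birch–Swinnerton-Dyer
quotients modulo squares*, Ann. of Math. 172 (2010), 567–596 (= arXiv:math/0610290), §1
"Notation" (p. 570 = arXiv pp. 4–5):

> "`c_v` — local Tamagawa number at a finite place `v`. `c(E/K)` — product of the local Tamagawa
> numbers, `= ∏_{v∤∞} c_v`. […] Finally, we will need a slight modification of `c(E/K)`. Fix an
> invariant differential `ω` on `E`. Let `ω_v°` be Néron differentials at finite places `v` of `K`,
> and set `C(E/K) = ∏_{v∤∞} c_v |ω/ω_v°|_v`. Note that `C(E/K)` depends on the choice of `ω`,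
> although we have omitted this from the notation. When writing `C(E/Lᵢ)` for various extensions
> `Lᵢ/K`, we always implicitly use the same `K`-rational differential."

This quantity is the Tamagawa/differential part of the Birch–Swinnerton-Dyer quotient (loc. cit.
§2.1, Conj. 2.1) and is the right-hand side of the authors' Selmer-rank congruences (Thm. 4.3,
Cor. 4.5, Prop. 4.17). This file **defines** it for a Weierstrass model `V` of an elliptic curve
over a number field `L`, with `ω = ω_V = dx/(2y + a₁x + a₃)` the invariant differential of the
model, and **proves** the two facts about it that §4.6 of the paper uses in the sentence "Since all
bad primes of `E` split in `M/K`, […] both `C(E/F)` and `C(E/M)` are squares" (p. 593 = arXiv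
p. 27, proof of Thm. 4.19): Galois invariance of the local factors, and the resulting squareness
criterion for a field involution pairing off the bad places. The application to the layers of the
anticyclotomic tower is in `ModifiedTamagawaProductAnticyclotomicSquares`.

## Definitions (namespace `WeierstrassCurve`, deliberate dot-notation extensions)

* `WeierstrassCurve.neronExponent w V : ℤ` — the exponent `k_w` with `|ω_V/ω_w°|_w = q_w^{k_w}`,
  namely `k_w = (ord_w Δ_V − ord_w Δ_min,w)/12`: a `w`-minimal model is `C • V` with scaling
  `u = u_w`, its differential is `ω_w° = u ω_V` and its discriminant `Δ_min,w = u⁻¹² Δ_V` (Silverman,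
  *AEC*, III.1, Table 3.1), so `|ω_V/ω_w°|_w = |u|_w⁻¹ = q_w^{ord_w u}` and `12 ord_w u = ord_w Δ_V −
  ord_w Δ_min,w`; here `ord_w Δ_V = -log (w.valuation L Δ_V)` and `ord_w Δ_min,w =
  V.ordMinimalDiscriminant w` (tree, `MinimalDiscriminant`). It may be negative (non-integral `V`).
* `WeierstrassCurve.localTamagawaFactor w V : ℚ` — `C_w := c_w · q_w^{k_w}` with
  `c_w = [E(L_w) : E₀(L_w)]` the tree's `localTamagawaNumber` of `V ⊗ L_w` over `𝒪_w` (the factor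
  of `WeierstrassCurve.tamagawaProduct`) and `q_w = #(𝓞 L / 𝔭_w)` (`Ideal.absNorm`).
* `WeierstrassCurve.modifiedTamagawaProduct V : ℚ` — `C(V/L) := ∏ᶠ_w C_w`. For a curve over a
  subfield `K ⊆ L` given by a `K`-model `W`, `C(E/L)` in the authors' sense (same `K`-rational
  `ω = ω_W` for all `L`) is `(W.baseChange L).modifiedTamagawaProduct`.

Junk values: for `Δ_V = 0` all exponents are junk (`log 0 = 0`, `ordMinimalDiscriminant = 0`);
`finprod` is `1` on infinite support (does not occur for elliptic `V`: `c_w ≠ 1` and `k_w ≠ 0` only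
at finitely many `w`; not needed below and not proved here).

## Results (all proved)

* `WeierstrassCurve.galAdicCompletionIntegersEquiv` — for `σ ∈ Aut(L/F)` and `σ • w = w'`, the
  restriction `𝒪_w ≃+* 𝒪_{w'}` of the tree's transport of completions `galAdicCompletionEquiv σ`
  (`Automorphic/GaloisActionPlaces`), compatible with it (`…_compat`);
* `WeierstrassCurve.localTamagawaFactor_algEquiv_smul` — **Galois invariance**: if the model `V` is
  fixed by `σ` coefficientwise (`V.map σ = V`, e.g. `V = W.baseChange L` with `W` over `F`), then
  `C_{σ w}(V) = C_w(V)`; from the tree's transport lemmas `localTamagawaNumber_map_ringEquiv`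
  (`TamagawaRingEquivProofs`), `addVal_Δ_minimal_ringEquiv'` (`MinimalDiscriminantRingOfIntegersProofs`),
  `valuation_algEquiv_smul` and `absNorm_algEquiv_smul` (`GaloisActionPlaces`) — Cassels–Fröhlich,
  Ch. VII §1.1 ("`σ` induces by continuity an isomorphism `σ_w : L_w → L_{σ w}`");
* `Finset.isSquare_prod_of_involutive` — a product over a finite set stable under an involution
  `τ` of a `τ`-invariant function whose values at the `τ`-fixed points are squares is a square;
* `WeierstrassCurve.isSquare_modifiedTamagawaProduct_of_algEquiv` — hence **`C(V/L)` is a square**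
  as soon as `L` has an automorphism `σ` with `σ² = 1` fixing `V` such that `C_w` is a square at
  every `σ`-fixed place `w` (the shape of the p. 27 argument: the bad places come in pairs
  `{w, σ w}` with equal factors);
* `WeierstrassCurve.localTamagawaFactor_baseChange_int_eq_one` — for a `ℤ`-model `W₀` and a place
  `w` of `L` above a prime `ℓ ∤ Δ(W₀)`: `W₀ ⊗ L_w` is an integral model with unit discriminant,
  hence minimal with good reduction (tree facts `isMinimalAt_of_lt_valuation_Δ`,
  `valuation_Δ_eq_of_isMinimalAt`, `ordMinimalDiscriminant_eq_zero_iff`,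
  `localTamagawaNumber_eq_one_of_hasGoodReduction`, all discharged), so `c_w = 1`, `k_w = 0` and
  `C_w = 1` (Silverman, *AEC*, VII.5.1(a) and VII.2, remark after Prop. 2.1).

No named facts, no `sorry`; D-0026: nothing is asserted.

## References

* [DokchitserDokchitserAnnals2010] T. Dokchitser, V. Dokchitser, *On the Birch–Swinnerton-Dyer
  quotients modulo squares*, Ann. of Math. 172 (2010), 567–596; arXiv:math/0610290: §1 Notation
  (pp. 4–5), §4.6 proof of Thm. 4.19 (p. 27).
* [SilvermanAEC2009] J. H. Silverman, *The Arithmetic of Elliptic Curves*, 2nd ed. (2009): III.1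
  Table 3.1 (`u⁻¹ω' = ω`, `u¹²Δ' = Δ`), VII.1 Prop. 1.3, VII.2 (remark after Prop. 2.1), VII.5.1(a).
* [CasselsFrohlichANT1967] J. W. S. Cassels, A. Fröhlich (eds.), *Algebraic Number Theory* (1967),
  Ch. VII (Tate), §1.1.
-/

noncomputable section

open scoped Classical
open IsDedekindDomain NumberField
open Literature.NumberTheory.Automorphic

namespace WeierstrassCurve

variable {L : Type*} [Field L] [NumberField L]

/-! ### The definitions -/

/-- The exponent `k_w ∈ ℤ` with `|ω_V/ω_w°|_w = q_w^{k_w}` for the invariant differential `ω_V` of the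
model `V` and a Néron (= `w`-minimal) differential `ω_w°`: `k_w = (ord_w Δ_V − ord_w Δ_min,w) / 12`
(`ω_{C•V} = u ω_V`, `Δ_{C•V} = u⁻¹² Δ_V` for a change of variables with scaling `u`, Silverman *AEC*
III.1 Table 3.1; `ord_w Δ_V = -log v_w(Δ_V)`, `ord_w Δ_min,w = V.ordMinimalDiscriminant w`). Junk value
for `Δ_V = 0`. (Dot-notation extension of the Mathlib namespace `WeierstrassCurve`.)
[cite: DokchitserDokchitserAnnals2010, §1 Notation (arXiv pp. 4–5)] -/
def neronExponent (w : HeightOneSpectrum (𝓞 L)) (V : WeierstrassCurve L) : ℤ :=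
  (-(WithZero.log (w.valuation L V.Δ)) - (V.ordMinimalDiscriminant w : ℤ)) / 12

/-- The local factor `C_w = c_w · |ω_V/ω_w°|_w = c_w · q_w^{k_w} ∈ ℚ` of Dokchitser–Dokchitser's
`C(E/L)` at the finite place `w`: `c_w = [E(L_w) : E₀(L_w)]` (the tree's `localTamagawaNumber` of
`V ⊗ L_w` over `𝒪_w`, as in `WeierstrassCurve.tamagawaProduct`), `q_w = #(𝓞 L ⧸ 𝔭_w)` and
`k_w = V.neronExponent w`. (Dot-notation extension of the Mathlib namespace `WeierstrassCurve`.)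
[cite: DokchitserDokchitserAnnals2010, §1 Notation (arXiv pp. 4–5)] -/
def localTamagawaFactor (w : HeightOneSpectrum (𝓞 L)) (V : WeierstrassCurve L) : ℚ :=
  ((V.baseChange (w.adicCompletion L)).localTamagawaNumber (w.adicCompletionIntegers L) : ℚ) *
    ((Ideal.absNorm w.asIdeal : ℕ) : ℚ) ^ (V.neronExponent w)

/-- **Dokchitser–Dokchitser's `C(E/L) = ∏_{w ∤ ∞} c_w |ω/ω_w°|_w`** for the Weierstrass model `V` over
the number field `L` and its invariant differential `ω = ω_V`: the `finprod` over the finite places of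
the local factors `localTamagawaFactor`. For `W` over a subfield `K` and extensions `L/K` the authors'
convention "always the same `K`-rational differential" is `(W.baseChange L).modifiedTamagawaProduct`.
Junk value `1` on infinite support. (Dot-notation extension of the Mathlib namespace `WeierstrassCurve`.)
[cite: DokchitserDokchitserAnnals2010, §1 Notation (arXiv pp. 4–5)] -/
def modifiedTamagawaProduct (V : WeierstrassCurve L) : ℚ :=
  ∏ᶠ w : HeightOneSpectrum (𝓞 L), V.localTamagawaFactor w

/-- Unfolding lemma for `modifiedTamagawaProduct`. [folklore] -/
theorem modifiedTamagawaProduct_def (V : WeierstrassCurve L) :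
    V.modifiedTamagawaProduct = ∏ᶠ w : HeightOneSpectrum (𝓞 L), V.localTamagawaFactor w := rfl

/-- Unfolding lemma for `localTamagawaFactor`. [folklore] -/
theorem localTamagawaFactor_def (w : HeightOneSpectrum (𝓞 L)) (V : WeierstrassCurve L) :
    V.localTamagawaFactor w =
      ((V.baseChange (w.adicCompletion L)).localTamagawaNumber (w.adicCompletionIntegers L) : ℚ) *
        ((Ideal.absNorm w.asIdeal : ℕ) : ℚ) ^ (V.neronExponent w) := rfl

/-! ### Galois invariance of the local factors -/

variable {F : Type*} [Field F] [Algebra F L]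

/-- The transport of completions `σ_w : L_w ≃+* L_{σ w}` along `σ ∈ Aut(L/F)`
(`galAdicCompletionEquiv`, file `Automorphic/GaloisActionPlaces`) preserves the valuation, hence
restricts to a ring isomorphism of the valuation rings `𝒪_w ≃+* 𝒪_{σ w}`
(Cassels–Fröhlich, Ch. VII §1.1: "`σ 𝔒_w = 𝔒_{σ w}`").
(Dot-notation extension of the Mathlib namespace `WeierstrassCurve`, where it is used.)
[cite: CasselsFrohlichANT1967, Ch. VII §1.1] -/
def galAdicCompletionIntegersEquiv (σ : L ≃ₐ[F] L) {w w' : HeightOneSpectrum (𝓞 L)}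
    (h : σ • w = w') : w.adicCompletionIntegers L ≃+* w'.adicCompletionIntegers L where
  toFun y := ⟨galAdicCompletionEquiv σ h y,
    (galAdicCompletionMap_mem_adicCompletionIntegers_iff L σ h y).mpr y.2⟩
  invFun y := ⟨(galAdicCompletionEquiv σ h).symm y,
    (galAdicCompletionMap_mem_adicCompletionIntegers_iff L σ⁻¹ (inv_smul_eq_of_smul_eq h) y).mpr y.2⟩
  left_inv y := by
    apply Subtype.ext
    exact (galAdicCompletionEquiv σ h).symm_apply_apply (y : w.adicCompletion L)
  right_inv y := by
    apply Subtype.ext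
    exact (galAdicCompletionEquiv σ h).apply_symm_apply (y : w'.adicCompletion L)
  map_mul' x y := by
    apply Subtype.ext
    change galAdicCompletionEquiv σ h ((x : w.adicCompletion L) * (y : w.adicCompletion L)) =
      galAdicCompletionEquiv σ h (x : w.adicCompletion L) *
        galAdicCompletionEquiv σ h (y : w.adicCompletion L)
    exact map_mul (galAdicCompletionEquiv σ h) _ _
  map_add' x y := by
    apply Subtype.ext
    change galAdicCompletionEquiv σ h ((x : w.adicCompletion L) + (y : w.adicCompletion L)) =
      galAdicCompletionEquiv σ h (x : w.adicCompletion L) +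
        galAdicCompletionEquiv σ h (y : w.adicCompletion L)
    exact map_add (galAdicCompletionEquiv σ h) _ _

/-- Compatibility of `galAdicCompletionIntegersEquiv σ h` with `galAdicCompletionEquiv σ h` along the
inclusions `𝒪_w ⊆ L_w`, `𝒪_{w'} ⊆ L_{w'}` (the hypothesis `hc` of the tree's transport lemmas).
[folklore] -/
theorem galAdicCompletionIntegersEquiv_compat (σ : L ≃ₐ[F] L) {w w' : HeightOneSpectrum (𝓞 L)}
    (h : σ • w = w') (r : w.adicCompletionIntegers L) :
    galAdicCompletionEquiv σ h (algebraMap _ (w.adicCompletion L) r) =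
      algebraMap _ (w'.adicCompletion L) (galAdicCompletionIntegersEquiv σ h r) := rfl

/-- If the model `V` is fixed coefficientwise by `σ`, its base change to `L_w` is carried by
`σ_w : L_w ≃+* L_{σ w}` to its base change to `L_{σ w}` (`σ_w` extends `σ`). [folklore] -/
theorem baseChange_map_galAdicCompletionEquiv (V : WeierstrassCurve L) (σ : L ≃ₐ[F] L)
    (hV : V.map (σ : L →+* L) = V) {w w' : HeightOneSpectrum (𝓞 L)} (h : σ • w = w') :
    (V.baseChange (w.adicCompletion L)).map
        ((galAdicCompletionEquiv σ h : w.adicCompletion L ≃+* w'.adicCompletion L) :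
          w.adicCompletion L →+* w'.adicCompletion L) =
      V.baseChange (w'.adicCompletion L) := by
  conv_rhs => rw [← hV]
  rw [baseChange, baseChange, map_map, map_map]
  congr 1
  refine RingHom.ext fun x => ?_
  simp only [RingHom.coe_comp, RingHom.coe_coe, Function.comp_apply, coe_galAdicCompletionEquiv]
  exact galAdicCompletionMap_coe_algEquiv F σ h x

/-- **`c_{σ w} = c_w`**: the Tamagawa number of a `σ`-fixed model at conjugate places agree (transport
along `σ_w`, the tree's `localTamagawaNumber_map_ringEquiv`; Silverman *AEC* VII.6 Ex. 7.6: `c` is an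
invariant of `E` over the discretely valued field). [cite: CasselsFrohlichANT1967, Ch. VII §1.1] -/
theorem localTamagawaNumber_algEquiv_smul (V : WeierstrassCurve L) [V.IsElliptic] (σ : L ≃ₐ[F] L)
    (hV : V.map (σ : L →+* L) = V) (w : HeightOneSpectrum (𝓞 L)) :
    (V.baseChange ((σ • w).adicCompletion L)).localTamagawaNumber ((σ • w).adicCompletionIntegers L) =
      (V.baseChange (w.adicCompletion L)).localTamagawaNumber (w.adicCompletionIntegers L) := by
  haveI : (V.baseChange (w.adicCompletion L)).IsElliptic := by rw [baseChange]; infer_instance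
  rw [← baseChange_map_galAdicCompletionEquiv V σ hV rfl]
  exact localTamagawaNumber_map_ringEquiv (galAdicCompletionIntegersEquiv σ rfl)
    (galAdicCompletionEquiv σ rfl) (galAdicCompletionIntegersEquiv_compat σ rfl) _

/-- **`ord_{σ w} Δ_min = ord_w Δ_min`** for a `σ`-fixed model (transport along `σ_w`, the tree's
`addVal_Δ_minimal_ringEquiv'`; Silverman *AEC* VII.1 Prop. 1.3(b)). [cite: CasselsFrohlichANT1967, Ch. VII §1.1] -/
theorem ordMinimalDiscriminant_algEquiv_smul (V : WeierstrassCurve L) (σ : L ≃ₐ[F] L)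
    (hV : V.map (σ : L →+* L) = V) (w : HeightOneSpectrum (𝓞 L)) :
    V.ordMinimalDiscriminant (σ • w) = V.ordMinimalDiscriminant w := by
  change (IsDiscreteValuationRing.addVal _
      ((((V.baseChange ((σ • w).adicCompletion L)).minimal _).integralModel _).Δ)).toNat =
    (IsDiscreteValuationRing.addVal _
      ((((V.baseChange (w.adicCompletion L)).minimal _).integralModel _).Δ)).toNat
  rw [addVal_Δ_minimal_ringEquiv' (galAdicCompletionIntegersEquiv σ rfl)
    (galAdicCompletionEquiv σ rfl) (galAdicCompletionIntegersEquiv_compat σ rfl)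
    (V.baseChange (w.adicCompletion L)) (baseChange_map_galAdicCompletionEquiv V σ hV rfl)]

/-- **`v_{σ w}(Δ_V) = v_w(Δ_V)`** for a `σ`-fixed model (`σ Δ_V = Δ_V` and `v_{σ w}(σ x) = v_w(x)`).
[cite: CasselsFrohlichANT1967, Ch. VII §1.1] -/
theorem valuation_Δ_algEquiv_smul (V : WeierstrassCurve L) (σ : L ≃ₐ[F] L)
    (hV : V.map (σ : L →+* L) = V) (w : HeightOneSpectrum (𝓞 L)) :
    (σ • w).valuation L V.Δ = w.valuation L V.Δ := by
  conv_lhs => rw [← hV, map_Δ]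
  exact HeightOneSpectrum.valuation_algEquiv_smul F σ w V.Δ

/-- `k_{σ w} = k_w` for a `σ`-fixed model. [folklore] -/
theorem neronExponent_algEquiv_smul (V : WeierstrassCurve L) (σ : L ≃ₐ[F] L)
    (hV : V.map (σ : L →+* L) = V) (w : HeightOneSpectrum (𝓞 L)) :
    V.neronExponent (σ • w) = V.neronExponent w := by
  rw [neronExponent, neronExponent, valuation_Δ_algEquiv_smul V σ hV,
    ordMinimalDiscriminant_algEquiv_smul V σ hV]

/-- **Galois invariance of the local factors `C_{σ w} = C_w`** of Dokchitser–Dokchitser's `C(E/L)` for a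
model fixed coefficientwise by `σ ∈ Aut(L/F)` (e.g. the base change of a model over `F`): `c_w`,
`q_w` and `k_w` are all invariant. This is the mechanism behind "Since all bad primes of `E` split
in `M/K`, […] `C(E/F)` and `C(E/M)` are squares" (loc. cit. §4.6, p. 27).
[cite: DokchitserDokchitserAnnals2010, §4.6, proof of Thm. 4.19 (arXiv p. 27)] -/
theorem localTamagawaFactor_algEquiv_smul (V : WeierstrassCurve L) [V.IsElliptic] (σ : L ≃ₐ[F] L)
    (hV : V.map (σ : L →+* L) = V) (w : HeightOneSpectrum (𝓞 L)) :
    V.localTamagawaFactor (σ • w) = V.localTamagawaFactor w := by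
  rw [localTamagawaFactor, localTamagawaFactor, localTamagawaNumber_algEquiv_smul V σ hV,
    neronExponent_algEquiv_smul V σ hV, HeightOneSpectrum.absNorm_algEquiv_smul F σ w]

/-! ### Squares -/

/-- A finite product of a `τ`-invariant function over a `τ`-stable finite set, `τ` an involution, is
a square as soon as its values at the `τ`-fixed points of the set are squares (pair off `a ≠ τ a`;
strong induction on the set). [folklore] -/
theorem _root_.Finset.isSquare_prod_of_involutive {α M : Type*} [CommMonoid M] [DecidableEq α]
    (τ : α → α) (hτ : Function.Involutive τ) (f : α → M) (hf : ∀ a, f (τ a) = f a)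
    (S : Finset α) (hS : ∀ a ∈ S, τ a ∈ S) (hfix : ∀ a ∈ S, τ a = a → IsSquare (f a)) :
    IsSquare (∏ a ∈ S, f a) := by
  induction S using Finset.strongInduction with
  | H S ih =>
    rcases S.eq_empty_or_nonempty with rfl | ⟨a, ha⟩
    · simp
    · by_cases hfa : τ a = a
      · rw [← Finset.insert_erase ha, Finset.prod_insert (S.notMem_erase a)]
        refine (hfix a ha hfa).mul (ih _ (Finset.erase_ssubset ha) ?_ ?_)
        · intro b hb
          rw [Finset.mem_erase] at hb ⊢
          refine ⟨fun h => hb.1 ?_, hS b hb.2⟩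
          rw [← hτ b, h, hfa]
        · exact fun b hb => hfix b (Finset.mem_of_mem_erase hb)
      · have hτa : τ a ∈ S := hS a ha
        have hτa' : τ a ∈ S.erase a := Finset.mem_erase.mpr ⟨hfa, hτa⟩
        rw [← Finset.insert_erase ha, Finset.prod_insert (S.notMem_erase a),
          ← Finset.insert_erase hτa', Finset.prod_insert ((S.erase a).notMem_erase (τ a)),
          ← mul_assoc, hf a]
        refine (IsSquare.mul_self (f a)).mul (ih _ ?_ ?_ ?_)
        · exact (Finset.erase_ssubset hτa').trans (Finset.erase_ssubset ha)
        · intro b hb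
          simp only [Finset.mem_erase] at hb ⊢
          refine ⟨fun h => hb.2.1 ?_, fun h => hb.1 ?_, hS b hb.2.2⟩
          · rw [← hτ b, h, hτ a]
          · rw [← hτ b, h]
        · intro b hb
          exact hfix b (Finset.mem_of_mem_erase (Finset.mem_of_mem_erase hb))

/-- **`C(V/L)` is a square when an involution of `L` pairs off the bad places.** If `σ ∈ Aut(L/F)`
with `σ² = 1` fixes the elliptic model `V` coefficientwise and the local factor `C_w` is a square at
every `σ`-fixed finite place `w`, then `C(V/L) = ∏ᶠ_w C_w` is a square: by Galois invariance
(`localTamagawaFactor_algEquiv_smul`) the support is `σ`-stable and the non-fixed places pair off.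
This is the argument of Dokchitser–Dokchitser, §4.6, proof of Thm. 4.19, for "both `C(E/F)` and
`C(E/M)` are squares" (there `σ` = complex conjugation of the dihedral field, and no bad place is
fixed because all bad primes split in the imaginary quadratic field).
[cite: DokchitserDokchitserAnnals2010, §4.6, proof of Thm. 4.19 (arXiv p. 27)] -/
theorem isSquare_modifiedTamagawaProduct_of_algEquiv (V : WeierstrassCurve L) [V.IsElliptic]
    (σ : L ≃ₐ[F] L) (hσ : σ * σ = 1) (hV : V.map (σ : L →+* L) = V)
    (hfix : ∀ w : HeightOneSpectrum (𝓞 L), σ • w = w → IsSquare (V.localTamagawaFactor w)) :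
    IsSquare V.modifiedTamagawaProduct := by
  unfold modifiedTamagawaProduct
  by_cases hfin : (Function.mulSupport fun w => V.localTamagawaFactor w).Finite
  · rw [finprod_eq_prod _ hfin]
    have hinv : Function.Involutive fun w : HeightOneSpectrum (𝓞 L) => σ • w := fun w => by
      change σ • σ • w = w
      rw [smul_smul, hσ, one_smul]
    refine Finset.isSquare_prod_of_involutive (fun w => σ • w) hinv _
      (fun w => localTamagawaFactor_algEquiv_smul V σ hV w) _ (fun w hw => ?_) (fun w _ hw => hfix w hw)
    rw [Set.Finite.mem_toFinset, Function.mem_mulSupport] at hw ⊢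
    rwa [localTamagawaFactor_algEquiv_smul V σ hV w]
  · rw [finprod_of_infinite_mulSupport hfin]
    exact ⟨1, (mul_one 1).symm⟩

/-! ### Places of good reduction of a `ℤ`-model contribute `1` -/

omit [NumberField L] in
/-- A prime of `𝓞 L` containing the rational prime `ℓ` lies over `(ℓ) ⊆ ℤ`. [folklore] -/
theorem _root_.Ideal.liesOver_span_of_natCast_mem' {Q : Ideal (𝓞 L)} [Q.IsPrime] {ℓ : ℕ}
    (hℓ : ℓ.Prime) (hmem : (ℓ : 𝓞 L) ∈ Q) : Q.LiesOver (Ideal.span {(ℓ : ℤ)}) := by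
  haveI : Fact ℓ.Prime := ⟨hℓ⟩
  rw [Ideal.liesOver_iff]
  refine Ideal.IsMaximal.eq_of_le (Int.ideal_span_isMaximal_of_prime ℓ) Ideal.IsPrime.ne_top' ?_
  rw [Ideal.span_singleton_le_iff_mem, Ideal.under_def, Ideal.mem_comap, algebraMap_int_eq,
    map_natCast]
  exact hmem

omit [NumberField L] in
/-- If `ℓ ∈ 𝔭_w` and `ℓ ∤ d` then `d ∉ 𝔭_w` (`𝔭_w ∩ ℤ = (ℓ)`). [folklore] -/
theorem intCast_notMem_asIdeal_of_not_dvd (w : HeightOneSpectrum (𝓞 L)) {ℓ : ℕ} (hℓ : ℓ.Prime)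
    (hℓw : (ℓ : 𝓞 L) ∈ w.asIdeal) {d : ℤ} (hd : ¬ (ℓ : ℤ) ∣ d) : (d : 𝓞 L) ∉ w.asIdeal := by
  intro hmem
  haveI : w.asIdeal.LiesOver (Ideal.span {(ℓ : ℤ)}) := Ideal.liesOver_span_of_natCast_mem' hℓ hℓw
  apply hd
  rw [← Ideal.mem_span_singleton, Ideal.LiesOver.over (P := w.asIdeal) (p := Ideal.span {(ℓ : ℤ)}),
    Ideal.under_def, Ideal.mem_comap, algebraMap_int_eq, eq_intCast]
  exact hmem

/-- For a `ℤ`-model `W₀` and a place `w` above a prime `ℓ ∤ Δ(W₀)`: `v_w(Δ(W₀ ⊗ L)) = 1`. [folklore] -/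
theorem valuation_Δ_baseChange_int_eq_one (W₀ : WeierstrassCurve ℤ) (w : HeightOneSpectrum (𝓞 L))
    {ℓ : ℕ} (hℓ : ℓ.Prime) (hℓw : (ℓ : 𝓞 L) ∈ w.asIdeal) (hd : ¬ (ℓ : ℤ) ∣ W₀.Δ) :
    w.valuation L (W₀.baseChange L).Δ = 1 := by
  rw [baseChange, map_Δ, eq_intCast, ← map_intCast (algebraMap (𝓞 L) L),
    HeightOneSpectrum.valuation_of_algebraMap, HeightOneSpectrum.intValuation_eq_one_iff]
  exact intCast_notMem_asIdeal_of_not_dvd w hℓ hℓw hd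

/-- The base change of a `ℤ`-model is integral at every finite place (`W₀ ⊗ 𝒪_w` is an integral
model). [folklore] -/
theorem isIntegralAt_baseChange_intModel (W₀ : WeierstrassCurve ℤ) (w : HeightOneSpectrum (𝓞 L)) :
    (W₀.baseChange L).IsIntegralAt w := by
  refine ⟨W₀.map (algebraMap ℤ (w.adicCompletionIntegers L)), ?_⟩
  rw [baseChange, baseChange, baseChange, map_map, map_map]
  congr 1
  exact Subsingleton.elim _ _

/-- **Good places contribute `1`.** For a `ℤ`-model `W₀` with `Δ(W₀) ≠ 0` and a finite place `w` of
`L` above a prime `ℓ ∤ Δ(W₀)`: `W₀ ⊗ L_w` is an integral model with unit discriminant, hence minimal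
at `w` (`isMinimalAt_of_lt_valuation_Δ`) with `ord_w Δ_min = 0` (`valuation_Δ_eq_of_isMinimalAt`),
i.e. of good reduction (`ordMinimalDiscriminant_eq_zero_iff`, Silverman *AEC* VII.5.1(a)), so
`c_w = 1` (`localTamagawaNumber_eq_one_of_hasGoodReduction`, *AEC* VII.2 after Prop. 2.1),
`k_w = 0`, and `C_w(W₀ ⊗ L) = 1`. [cite: SilvermanAEC2009, VII.5 Prop. 5.1(a) and VII.2 (remark after Prop. 2.1)] -/
theorem localTamagawaFactor_baseChange_int_eq_one (W₀ : WeierstrassCurve ℤ) (hΔ : W₀.Δ ≠ 0)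
    (w : HeightOneSpectrum (𝓞 L)) {ℓ : ℕ} (hℓ : ℓ.Prime) (hℓw : (ℓ : 𝓞 L) ∈ w.asIdeal)
    (hd : ¬ (ℓ : ℤ) ∣ W₀.Δ) : (W₀.baseChange L).localTamagawaFactor w = 1 := by
  set V := W₀.baseChange L with hV
  haveI : V.IsElliptic := by
    refine ⟨isUnit_iff_ne_zero.mpr ?_⟩
    rw [hV, baseChange, map_Δ, eq_intCast, Int.cast_ne_zero]
    exact hΔ
  have hval : w.valuation L V.Δ = 1 := valuation_Δ_baseChange_int_eq_one W₀ w hℓ hℓw hd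
  have hmin : V.IsMinimalAt w := by
    refine isMinimalAt_of_lt_valuation_Δ_holds (isIntegralAt_baseChange_intModel W₀ w) ?_
    rw [hval, ← WithZero.exp_zero, WithZero.exp_lt_exp]
    norm_num
  have hord : V.ordMinimalDiscriminant w = 0 := by
    have h := valuation_Δ_eq_of_isMinimalAt_holds (v := w) (W := V) hmin
    rw [hval, eq_comm, WithZero.exp_eq_one] at h
    omega
  have hgood : V.HasGoodReductionAt w := (ordMinimalDiscriminant_eq_zero_iff_holds w V).mp hord
  have hc : (V.baseChange (w.adicCompletion L)).localTamagawaNumber (w.adicCompletionIntegers L) = 1 := by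
    haveI : ((V.baseChange (w.adicCompletion L)).minimal (w.adicCompletionIntegers L)).HasGoodReduction
        (w.adicCompletionIntegers L) := hgood
    exact localTamagawaNumber_eq_one_of_hasGoodReduction_holds _ _
  rw [localTamagawaFactor, hc, neronExponent, hval, hord, WithZero.log_one]
  simp

end WeierstrassCurve
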